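import Mathlib
import Summits.Schanuel.Schanuel.Theorems.DiophantineDichotomyKhovanskiiApproxTypeEvLambertChallengerLevel
import HarnessLib

/-!
# Route `DiophantineDichotomy`, crux `KhovanskiiApproxTypeEv` (stmt-Schanuel-14972), line `lambert-liouville-kill`:
# stub `stub_expRationalLevel` — level `(d, H)` of the exp-rational challenger `(1, p/q, α, v/u)`

Crux `Summit.Schanuel.Schanuel.Theses.DiophantineDichotomy.KhovanskiiApproxTypeEv` (item stmt-Schanuel-14972),
certificate line `lambert-liouville-kill` (skeleton `Cruxes/KhovanskiiApproxTypeEv/Lines/lambert_liouville_kill.lean`,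
lead `prover-line-stmt-Schanuel-14972-a1-0`), registered stub `stub_expRationalLevel` (landed `--supports stmt-Schanuel-14972`).

In the exp-rational extension `notLiouville_expRational_of_ev` of the certificate the eventual crux
`ApproxTypeEvAt 2 (1, x)` is fed the challenger `γ = (1, p/q, α, v/u) : Fin 2 ⊕ Fin 2 → ℂ` with INTEGER data
`p, u ≠ 0, v` and `q ≥ 1` (`α` a root of a non-zero `P ∈ ℤ[X]` of degree `≤ d` and height `≤ H`,
`q, |p|, |u|, |v| ≤ H`).  This stub certifies its LEVEL `(d, H)`:
* `[ℚ(γ):ℚ] ≤ d`: `ℚ(γ) ≤ ℚ(α)` (the other three coordinates are rational), and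
  `[ℚ(α):ℚ] = deg (minpoly α) ≤ deg P ≤ d` (`IntermediateField.adjoin.finrank`, `minpoly.degree_le_of_ne_zero`);
* each coordinate is a root of a non-zero integer polynomial of degree `≤ d` and height `≤ H`:
  `X − 1`, `q X − p`, `P`, `u X − v` (heights `1`, `max q |p|`, `≤ H`, `max |u| |v|`, all `≤ H`).
The integer linear certificates come from `exists_linearCertInt`, the signed variant of the landed
`exists_linearCert` (`…LambertChallengerLevel`, whose `stub_challengerLevel` is the natural-number template).
Mathlib only.
-/

noncomputable section

-- `Summit.Schanuel.Schanuel.…` is the mandated summit/sub-problem namespace (single-conjunct summit), hence: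
set_option linter.dupNamespace false

namespace Summit.Schanuel.Schanuel.Cruxes.KhovanskiiApproxTypeEv.LambertLiouvilleKill

open Polynomial

/-- The linear integer certificate `u X − v` of a rational number `v/u` with SIGNED data: for integers
`u ≠ 0`, `v` with `|u|, |v| ≤ H`, `1 ≤ d` and any `z` with `u z = v`, the polynomial
`C u * X − C v ∈ ℤ[X]` is non-zero, of degree `≤ 1 ≤ d`, of height `max |u| |v| ≤ H`, and vanishes
at `z` (signed variant of `exists_linearCert`). [folklore] -/
theorem exists_linearCertInt (u v : ℤ) (H d : ℕ) (hu : u ≠ 0) (huH : |u| ≤ H) (hvH : |v| ≤ H)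
    (hd : 1 ≤ d) (z : ℂ) (hz : (u : ℂ) * z = v) :
    ∃ Q : Polynomial ℤ, Q ≠ 0 ∧ Q.natDegree ≤ d ∧ (∀ j, |Q.coeff j| ≤ (H : ℤ)) ∧
      Polynomial.aeval z Q = 0 := by
  refine ⟨C u * X - C v, ?_, ?_, ?_, ?_⟩
  · intro h
    have h1 : (C u * X - C v).coeff 1 = u := by
      rw [coeff_sub, coeff_C_mul, coeff_X, coeff_C]
      simp
    rw [h, coeff_zero] at h1
    exact hu h1.symm
  · calc (C u * X - C v).natDegree
        ≤ max (C u * X).natDegree (C v).natDegree := natDegree_sub_le _ _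
      _ ≤ 1 := max_le ((natDegree_C_mul_le _ _).trans natDegree_X_le)
          (by rw [natDegree_C]; exact Nat.zero_le _)
      _ ≤ d := hd
  · intro j
    rw [coeff_sub, coeff_C_mul, coeff_X, coeff_C]
    rcases j with _ | _ | j
    · simpa using hvH
    · simpa using huH
    · simp
  · have h : Polynomial.aeval z (C u * X - C v) = (u : ℂ) * z - v := by
      simp
    rw [h, hz, sub_self]

/-- **STUB F3b (level of the exp-rational challenger).**  For `α` a root of a non-zero `P ∈ ℤ[X]` of
degree `≤ d` and height `≤ H`, integers `p`, `u ≠ 0`, `v` and a natural number `q ≥ 1` with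
`q, |p|, |u|, |v| ≤ H` (`1 ≤ d`), the challenger `γ = (1, p/q, α, v/u) ∈ ℚ(α)⁴` has
`[ℚ(γ):ℚ] ≤ [ℚ(α):ℚ] = deg (minpoly_ℚ α) ≤ deg P ≤ d`, and its coordinates are roots of `X − 1`,
`q X − p`, `P`, `u X − v` — all non-zero, of degree `≤ d` and height `≤ H`.  Proof: `ℚ(γ) ≤ ℚ(α)` by
`IntermediateField.adjoin_le_iff` (`1`, `p/q`, `v/u` lie in every intermediate field),
`IntermediateField.finrank_le_of_le_right`, `IntermediateField.adjoin.finrank`,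
`minpoly.degree_le_of_ne_zero` on `P.map (Int.castRingHom ℚ)`; the certificates by
`exists_linearCertInt`. [folklore; signed variant of `stub_challengerLevel`] -/
theorem stub_expRationalLevel :
    ∀ (d H q : ℕ) (p u v : ℤ) (α : ℂ) (P : ℤ[X]), 1 ≤ d → 1 ≤ q → (q : ℤ) ≤ H → |p| ≤ H →
      u ≠ 0 → |u| ≤ H → |v| ≤ H →
      P ≠ 0 → Polynomial.aeval α P = 0 → P.natDegree ≤ d → (∀ i, |P.coeff i| ≤ (H : ℤ)) →
      Module.finrank ℚ ↥(IntermediateField.adjoin ℚ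
          (Set.range (Sum.elim ![(1 : ℂ), (p : ℂ) / q] ![α, (v : ℂ) / u]))) ≤ d ∧
        ∀ i, ∃ Q : Polynomial ℤ, Q ≠ 0 ∧ Q.natDegree ≤ d ∧ (∀ j, |Q.coeff j| ≤ (H : ℤ)) ∧
          Polynomial.aeval (Sum.elim ![(1 : ℂ), (p : ℂ) / q] ![α, (v : ℂ) / u] i) Q = 0 := by
  intro d H q p u v α P hd hq1 hqH hpH hu0 huH hvH hP0 hPα hPdeg hPcoef
  -- elementary size bookkeeping: 1 ≤ q ≤ H, casts of q and u are non-zero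
  have hq0 : (q : ℂ) ≠ 0 := by exact_mod_cast (show q ≠ 0 by omega)
  have hq0Z : (q : ℤ) ≠ 0 := by exact_mod_cast (show q ≠ 0 by omega)
  have hu0C : (u : ℂ) ≠ 0 := by exact_mod_cast hu0
  have hH1 : |(1 : ℤ)| ≤ H := by
    rw [abs_one]
    exact le_trans (by exact_mod_cast hq1) hqH
  have hqabs : |(q : ℤ)| ≤ H := by rwa [Int.abs_natCast]
  -- α is algebraic over ℚ, annihilated by `P.map (Int.castRingHom ℚ) ≠ 0`
  have hPQ0 : P.map (Int.castRingHom ℚ) ≠ 0 :=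
    (Polynomial.map_ne_zero_iff (Int.castRingHom ℚ).injective_int).mpr hP0
  have hPQα : Polynomial.aeval α (P.map (Int.castRingHom ℚ)) = 0 := by
    rw [← algebraMap_int_eq, aeval_map_algebraMap]; exact hPα
  have hαint : IsIntegral ℚ α := (show IsAlgebraic ℚ α from ⟨_, hPQ0, hPQα⟩).isIntegral
  refine ⟨?_, ?_⟩
  · -- `ℚ(γ) ≤ ℚ(α)` and `[ℚ(α):ℚ] = natDegree (minpoly ℚ α) ≤ natDegree P ≤ d`
    have hle : IntermediateField.adjoin ℚ
          (Set.range (Sum.elim ![(1 : ℂ), (p : ℂ) / q] ![α, (v : ℂ) / u])) ≤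
        IntermediateField.adjoin ℚ {α} := by
      rw [IntermediateField.adjoin_le_iff]
      rintro _ ⟨i, rfl⟩
      rcases i with i | i <;> fin_cases i
      · exact one_mem _
      · exact div_mem (intCast_mem _ p) (natCast_mem _ q)
      · exact IntermediateField.mem_adjoin_simple_self ℚ α
      · exact div_mem (intCast_mem _ v) (intCast_mem _ u)
    haveI : FiniteDimensional ℚ (IntermediateField.adjoin ℚ {α}) :=
      IntermediateField.adjoin.finiteDimensional hαint
    refine (IntermediateField.finrank_le_of_le_right hle).trans ?_
    rw [IntermediateField.adjoin.finrank hαint]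
    refine le_trans ?_ hPdeg
    have h' := natDegree_le_natDegree (minpoly.degree_le_of_ne_zero ℚ α hPQ0 hPQα)
    rwa [natDegree_map_eq_of_injective (Int.castRingHom ℚ).injective_int] at h'
  · -- the four certificates `X − 1`, `q X − p`, `P`, `u X − v`
    refine Sum.forall.mpr ⟨Fin.forall_fin_two.mpr ⟨?_, ?_⟩, Fin.forall_fin_two.mpr ⟨?_, ?_⟩⟩
    · exact exists_linearCertInt 1 1 H d one_ne_zero hH1 hH1 hd 1 (by norm_num)
    · exact exists_linearCertInt (q : ℤ) p H d hq0Z hqabs hpH hd ((p : ℂ) / q)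
        (by push_cast; field_simp)
    · exact ⟨P, hP0, hPdeg, hPcoef, hPα⟩
    · exact exists_linearCertInt u v H d hu0 huH hvH hd ((v : ℂ) / u) (by field_simp)

end Summit.Schanuel.Schanuel.Cruxes.KhovanskiiApproxTypeEv.LambertLiouvilleKill

end
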